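import Mathlib
import Summits.Ventures.PercRepro2.SwOutCrossGenCore

/-!
# The generic cross-arm cube: THE ABSTRACT THEOREM for every fibre data (blind cell PercRepro2,
night-4 g23, 2026-08-28; proofs/NIGHT4-G23.md §8)

**`card_le_crossGen`**: for every `FibreData` `F`, every up-set `𝒯` of types and every up-set
`𝓔` of atom sets, `#{q ∈ QG F 𝒯 : ERG F q ∈ 𝓔} ≤ #{q ∈ QG F 𝒯 : EBG F q ∈ 𝓔}` — the proof of
`SwOutCrossThm` with the finite facts of the fibre taken from `F`: a non-core point has all u-arms
red or all blue (`F.core_of_noLeak`), the slab injection `F.psi` carries the T-slab count into the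
B-slab count, and the core points, paired by the flip (`F.core0`), are counted by the cube principle
and the pairwise rearrangement (`pair_card_le`).
-/

namespace Summit.Ventures.PercRepro2

namespace CrossArm

open LocRows

variable {W A L : Type*} {F : FibreData W A L} {ι : Type*}

open scoped Classical

section Slabs

/-- All u-arms red. -/
def sTopG : Config ι := fun _ => true

/-- All u-arms blue. -/
def sBotG : Config ι := fun _ => false

variable [Nonempty ι]

/-- `u` is red at the top. -/
lemma redUG_top : redUG (sTopG : Config ι) := ⟨Classical.arbitrary ι, rfl⟩

omit [Nonempty ι] in
/-- `u` is not red at the bottom. -/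
lemma not_redUG_bot : ¬ redUG (sBotG : Config ι) := fun ⟨_, hj⟩ => Bool.noConfusion hj

omit [Nonempty ι] in
/-- The flip of the top is the bottom. -/
lemma flipAll_sTopG : flipAll (sTopG : Config ι) = sBotG := rfl

omit [Nonempty ι] in
/-- The flip of the bottom is the top. -/
lemma flipAll_sBotG : flipAll (sBotG : Config ι) = sTopG := rfl

omit [Nonempty ι] in
/-- At the bottom the red atoms are empty. -/
lemma ERG_sBot (w : W) : ERG F ((sBotG : Config ι), w) = ∅ := by
  ext a
  rcases a with j | _ | a
  · exact ⟨fun h => Bool.noConfusion h, fun h => h.elim⟩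
  · exact ⟨fun h => not_redUG_bot h, fun h => h.elim⟩
  · exact ⟨fun h => not_redUG_bot h.1, fun h => h.elim⟩

omit [Nonempty ι] in
/-- At the top the blue atoms are empty. -/
lemma EBG_sTop (w : W) : EBG F ((sTopG : Config ι), w) = ∅ := by
  rw [EBG_eq, flipAll_sTopG, ERG_sBot]

omit [Nonempty ι] in
/-- A non-leaking non-core point has all u-arms red or all u-arms blue. -/
lemma top_or_bot_of_not_coreG {q : PtG W ι} (hq : ¬ LeakG F q) (hc : F.core q.2 = false) :
    q.1 = sTopG ∨ q.1 = sBotG := by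
  by_contra h
  have hnt : q.1 ≠ sTopG := fun h' => h (Or.inl h')
  have hnb : q.1 ≠ sBotG := fun h' => h (Or.inr h')
  have hr : redUG q.1 := by
    by_contra hr
    apply hnb
    funext j
    cases hj : q.1 j with
    | true => exact absurd ⟨j, hj⟩ hr
    | false => rfl
  have hb : blueUG q.1 := by
    by_contra hb
    apply hnt
    funext j
    cases hj : q.1 j with
    | false => exact absurd ⟨j, hj⟩ hb
    | true => rfl
  have h1 : F.leakR q.2 = false := by
    cases hL : F.leakR q.2 with
    | false => rfl
    | true => exact absurd (Or.inl ⟨hr, hL⟩) hq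
  have h2 : F.leakR (F.flip q.2) = false := by
    cases hL : F.leakR (F.flip q.2) with
    | false => rfl
    | true => exact absurd (Or.inr ⟨hb, hL⟩) hq
  have := F.core_of_noLeak q.2 h1 h2
  rw [hc] at this
  exact Bool.noConfusion this

end Slabs

section Count

variable {𝒯 : Set (TypG L ι)}

/-- Core points do not leak. -/
lemma not_leakG_of_core {q : PtG W ι} (hc : F.core q.2 = true) : ¬ LeakG F q := by
  rintro (⟨-, h⟩ | ⟨-, h⟩)
  · rw [F.leakR_core _ hc] at h; exact Bool.noConfusion h
  · rw [F.leakR_flip_core _ hc] at h; exact Bool.noConfusion h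

/-- The flip is injective. -/
lemma flip_injective (F : FibreData W A L) : Function.Injective F.flip := by
  intro w w' h
  rw [← F.flip_flip w, h, F.flip_flip]

variable [DecidableEq W]

/-- All core points. -/
def coreAll (F : FibreData W A L) : Finset W := F.core0 ∪ F.core0.image F.flip

/-- A core point lies in `coreAll`. -/
lemma mem_coreAll_of_core {w : W} (hw : F.core w = true) : w ∈ coreAll F := by
  rcases F.core_cases w hw with h | ⟨w₀, hw₀, rfl⟩
  · exact Finset.mem_union_left _ h
  · exact Finset.mem_union_right _ (Finset.mem_image_of_mem _ hw₀)

variable [Fintype ι] [DecidableEq ι] [Fintype W]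

omit [DecidableEq W] in
/-- Membership in `QG`. -/
lemma mem_QG {q : PtG W ι} : q ∈ QG F 𝒯 ↔ ¬ LeakG F q ∧ typG F q ∈ 𝒯 := by
  simp only [QG, Finset.mem_filter, Finset.mem_univ, true_and]

/-- Counting the points of `QG` on a core fibre point `w` by their u-arm bits. -/
lemma card_core_fiberG (w : W) (hw : F.core w = true) (R : Config ι → Prop) :
    ((QG F 𝒯).filter fun q => q.2 = w ∧ R q.1).card =
      (Finset.univ.filter fun s => s ∈ DG F 𝒯 w ∧ R s).card := by
  refine Finset.card_bij' (fun q _ => q.1) (fun s _ => (s, w)) ?_ ?_ ?_ ?_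
  · intro q hq
    simp only [Finset.mem_filter, mem_QG] at hq
    simp only [Finset.mem_filter, Finset.mem_univ, true_and, DG, Set.mem_setOf_eq]
    obtain ⟨⟨-, ht⟩, hw', hR⟩ := hq
    refine ⟨?_, hR⟩
    simpa [typG, hw'] using ht
  · intro s hs
    simp only [Finset.mem_filter, Finset.mem_univ, true_and, DG, Set.mem_setOf_eq] at hs
    exact Finset.mem_filter.2 ⟨mem_QG.2 ⟨not_leakG_of_core hw, hs.1⟩, rfl, hs.2⟩
  · intro q hq
    simp only [Finset.mem_filter] at hq
    exact Prod.ext rfl hq.2.1.symm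
  · intro s _
    rfl

/-- The core count of a predicate, as a sum over the pairs of core points. -/
lemma card_core_eqG (P : PtG W ι → Prop) :
    ((QG F 𝒯).filter fun q => P q ∧ F.core q.2 = true).card =
      ∑ w ∈ F.core0, (((QG F 𝒯).filter fun q => q.2 = w ∧ P q).card +
        ((QG F 𝒯).filter fun q => q.2 = F.flip w ∧ P q).card) := by
  rw [Finset.card_eq_sum_card_fiberwise (f := Prod.snd) (t := coreAll F)
    (fun q hq => mem_coreAll_of_core (Finset.mem_filter.1 hq).2.2)]
  have key : ∀ w : W, F.core w = true →
      (((QG F 𝒯).filter fun q => P q ∧ F.core q.2 = true).filter fun q => q.2 = w) =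
        (QG F 𝒯).filter fun q => q.2 = w ∧ P q := by
    intro w hw
    rw [Finset.filter_filter]
    apply Finset.filter_congr
    intro q _
    constructor
    · rintro ⟨⟨hP, -⟩, hq⟩; exact ⟨hq, hP⟩
    · rintro ⟨hq, hP⟩; exact ⟨⟨hP, hq ▸ hw⟩, hq⟩
  have hdisj : Disjoint F.core0 (F.core0.image F.flip) := by
    rw [Finset.disjoint_left]
    intro w hw hw'
    obtain ⟨w₀, hw₀, rfl⟩ := Finset.mem_image.1 hw'
    exact F.flip_core0 w₀ hw₀ hw
  unfold coreAll
  rw [Finset.sum_union hdisj, Finset.sum_image (fun w _ w' _ h => flip_injective F h),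
    ← Finset.sum_add_distrib]
  refine Finset.sum_congr rfl fun w hw => ?_
  rw [key w (F.core0_core w hw), key (F.flip w) (F.core_flip w (F.core0_core w hw))]

/-- The red core count on a fibre point, as a count over the u-arm cube. -/
lemma card_core_ERG (𝓔 : Set (Set (AtomG A ι))) (w : W) (hw : F.core w = true) :
    ((QG F 𝒯).filter fun q => q.2 = w ∧ ERG F q ∈ 𝓔).card =
      (Finset.univ.filter (· ∈ DG F 𝒯 w ∩ AG F 𝓔 w)).card := by
  have h := card_core_fiberG (F := F) (𝒯 := 𝒯) w hw (fun s => ERG F (s, w) ∈ 𝓔)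
  have e1 : ((QG F 𝒯).filter fun q => q.2 = w ∧ ERG F q ∈ 𝓔) =
      (QG F 𝒯).filter fun q => q.2 = w ∧ ERG F (q.1, w) ∈ 𝓔 := by
    apply Finset.filter_congr
    intro q _
    constructor
    · rintro ⟨hq, hE⟩
      have hqw : q = (q.1, w) := Prod.ext rfl hq
      exact ⟨hq, by rw [hqw] at hE; exact hE⟩
    · rintro ⟨hq, hE⟩
      have hqw : q = (q.1, w) := Prod.ext rfl hq
      exact ⟨hq, by rw [hqw]; exact hE⟩
  have e2 : (Finset.univ.filter fun s => s ∈ DG F 𝒯 w ∧ ERG F (s, w) ∈ 𝓔) =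
      Finset.univ.filter (· ∈ DG F 𝒯 w ∩ AG F 𝓔 w) := by
    apply Finset.filter_congr
    intro s _
    exact Iff.rfl
  rw [e1, h, e2]

/-- The blue core count on a fibre point, as a count over the u-arm cube (the flipped fibre). -/
lemma card_core_EBG (𝓔 : Set (Set (AtomG A ι))) (w : W) (hw : F.core w = true) :
    ((QG F 𝒯).filter fun q => q.2 = w ∧ EBG F q ∈ 𝓔).card =
      (Finset.univ.filter (· ∈ DG F 𝒯 w ∩ FlG F 𝓔 (F.flip w))).card := by
  have h := card_core_fiberG (F := F) (𝒯 := 𝒯) w hw (fun s => EBG F (s, w) ∈ 𝓔)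
  have e1 : ((QG F 𝒯).filter fun q => q.2 = w ∧ EBG F q ∈ 𝓔) =
      (QG F 𝒯).filter fun q => q.2 = w ∧ EBG F (q.1, w) ∈ 𝓔 := by
    apply Finset.filter_congr
    intro q _
    constructor
    · rintro ⟨hq, hE⟩
      have hqw : q = (q.1, w) := Prod.ext rfl hq
      exact ⟨hq, by rw [hqw] at hE; exact hE⟩
    · rintro ⟨hq, hE⟩
      have hqw : q = (q.1, w) := Prod.ext rfl hq
      exact ⟨hq, by rw [hqw]; exact hE⟩
  have e2 : (Finset.univ.filter fun s => s ∈ DG F 𝒯 w ∧ EBG F (s, w) ∈ 𝓔) =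
      Finset.univ.filter (· ∈ DG F 𝒯 w ∩ FlG F 𝓔 (F.flip w)) := by
    apply Finset.filter_congr
    intro s _
    exact Iff.rfl
  rw [e1, h, e2]

/-- **The core inequality.** -/
theorem core_le (h𝒯 : IsUpG F 𝒯) {𝓔 : Set (Set (AtomG A ι))} (h𝓔 : IsUpperSet 𝓔) :
    ((QG F 𝒯).filter fun q => ERG F q ∈ 𝓔 ∧ F.core q.2 = true).card ≤
      ((QG F 𝒯).filter fun q => EBG F q ∈ 𝓔 ∧ F.core q.2 = true).card := by
  rw [card_core_eqG, card_core_eqG]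
  refine Finset.sum_le_sum fun w hw => ?_
  have hc := F.core0_core w hw
  have hc' := F.core_flip w hc
  rw [card_core_ERG 𝓔 w hc, card_core_ERG 𝓔 (F.flip w) hc', card_core_EBG 𝓔 w hc,
    card_core_EBG 𝓔 (F.flip w) hc', F.flip_flip]
  exact pair_card_le h𝒯 h𝓔 hw

variable [Nonempty ι]

omit [DecidableEq W] in
/-- Splitting a count of `QG` into the core, the T-slab and the B-slab. -/
lemma card_splitG (P : PtG W ι → Prop) :
    ((QG F 𝒯).filter fun q => P q).card =
      ((QG F 𝒯).filter fun q => P q ∧ F.core q.2 = true).card +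
        ((QG F 𝒯).filter fun q => P q ∧ F.core q.2 = false ∧ q.1 = sTopG).card +
        ((QG F 𝒯).filter fun q => P q ∧ F.core q.2 = false ∧ q.1 = sBotG).card := by
  have h1 := Finset.card_filter_add_card_filter_not (s := (QG F 𝒯).filter fun q => P q)
    (fun q => F.core q.2 = true)
  have h2 := Finset.card_filter_add_card_filter_not
    (s := (QG F 𝒯).filter fun q => P q ∧ ¬ F.core q.2 = true) (fun q => q.1 = sTopG)
  simp only [Finset.filter_filter] at h1 h2
  have e1 : ((QG F 𝒯).filter fun q => (P q ∧ ¬ F.core q.2 = true) ∧ q.1 = sTopG) =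
      (QG F 𝒯).filter fun q => P q ∧ F.core q.2 = false ∧ q.1 = sTopG := by
    apply Finset.filter_congr
    intro q _
    constructor
    · rintro ⟨⟨hP, hc⟩, ht⟩
      have hc' : F.core q.2 = false := by cases h : F.core q.2 <;> simp_all
      exact ⟨hP, hc', ht⟩
    · rintro ⟨hP, hc, ht⟩
      exact ⟨⟨hP, fun h => by rw [hc] at h; exact Bool.noConfusion h⟩, ht⟩
  have e2 : ((QG F 𝒯).filter fun q => (P q ∧ ¬ F.core q.2 = true) ∧ ¬ q.1 = sTopG) =
      (QG F 𝒯).filter fun q => P q ∧ F.core q.2 = false ∧ q.1 = sBotG := by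
    apply Finset.filter_congr
    intro q hq
    constructor
    · rintro ⟨⟨hP, hc⟩, ht⟩
      have hc' : F.core q.2 = false := by cases h : F.core q.2 <;> simp_all
      rcases top_or_bot_of_not_coreG (mem_QG.1 hq).1 hc' with h | h
      · exact absurd h ht
      · exact ⟨hP, hc', h⟩
    · rintro ⟨hP, hc, hb⟩
      refine ⟨⟨hP, fun h => by rw [hc] at h; exact Bool.noConfusion h⟩, fun ht => ?_⟩
      have := congrFun (hb.symm.trans ht) (Classical.arbitrary ι)
      exact Bool.noConfusion this
  rw [e1, e2] at h2
  omega

omit [DecidableEq W] in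
/-- **The slab injection**: the red T-slab count is at most the blue B-slab count. -/
lemma card_slab_leG (h𝒯 : IsUpG F 𝒯) {𝓔 : Set (Set (AtomG A ι))} (h𝓔 : IsUpperSet 𝓔) :
    ((QG F 𝒯).filter fun q => ERG F q ∈ 𝓔 ∧ F.core q.2 = false ∧ q.1 = sTopG).card ≤
      ((QG F 𝒯).filter fun q => EBG F q ∈ 𝓔 ∧ F.core q.2 = false ∧ q.1 = sBotG).card := by
  refine Finset.card_le_card_of_injOn (fun q => ((sBotG : Config ι), F.psi q.2)) ?_ ?_
  · intro q hq
    rw [Finset.mem_coe, Finset.mem_filter, mem_QG] at hq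
    obtain ⟨⟨hnl, ht⟩, hE, hc, hs⟩ := hq
    have hR : F.leakR q.2 = false := by
      cases hL : F.leakR q.2 with
      | false => rfl
      | true => exact absurd (Or.inl ⟨hs ▸ redUG_top, hL⟩) hnl
    obtain ⟨hB, hc', hl, hred⟩ := F.psi_ok q.2 hR hc
    rw [Finset.mem_coe, Finset.mem_filter, mem_QG]
    refine ⟨⟨?_, ?_⟩, ?_, hc', rfl⟩
    · rintro (⟨h, -⟩ | ⟨-, h⟩)
      · exact not_redUG_bot h
      · rw [hB] at h; exact Bool.noConfusion h
    · refine h𝒯 _ ht _ ⟨fun j hj => ?_, hl⟩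
      have hj' : q.1 j = false := hj
      rw [hs] at hj'
      exact Bool.noConfusion hj'
    · rw [EBG_eq, flipAll_sBotG]
      refine h𝓔 ?_ hE
      have hqw : q = (sTopG, q.2) := Prod.ext hs rfl
      rw [hqw]
      exact ERG_mono_fib _ hred
  · intro q hq q' hq' heq
    rw [Finset.mem_coe, Finset.mem_filter, mem_QG] at hq hq'
    have heq' : F.psi q.2 = F.psi q'.2 := (Prod.mk.inj heq).2
    obtain ⟨⟨hnl, -⟩, -, hc, hs⟩ := hq
    obtain ⟨⟨hnl', -⟩, -, hc', hs'⟩ := hq'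
    have hR : F.leakR q.2 = false := by
      cases hL : F.leakR q.2 with
      | false => rfl
      | true => exact absurd (Or.inl ⟨hs ▸ redUG_top, hL⟩) hnl
    have hR' : F.leakR q'.2 = false := by
      cases hL : F.leakR q'.2 with
      | false => rfl
      | true => exact absurd (Or.inl ⟨hs' ▸ redUG_top, hL⟩) hnl'
    exact Prod.ext (hs.trans hs'.symm) (F.psi_inj _ _ hR hc hR' hc' heq')

/-- **THE ABSTRACT THEOREM OF BOUNDARY (iv) FOR EVERY FIBRE DATA**: on every up-set of types of
the cube, the red count is at most the blue count for every up-set of atom sets. -/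
theorem card_le_crossGen (h𝒯 : IsUpG F 𝒯) {𝓔 : Set (Set (AtomG A ι))} (h𝓔 : IsUpperSet 𝓔) :
    ((QG F 𝒯).filter fun q => ERG F q ∈ 𝓔).card ≤ ((QG F 𝒯).filter fun q => EBG F q ∈ 𝓔).card := by
  by_cases hE : (∅ : Set (AtomG A ι)) ∈ 𝓔
  · have hall : ∀ A : Set (AtomG A ι), A ∈ 𝓔 := fun A => h𝓔 (Set.empty_subset A) hE
    rw [Finset.filter_true_of_mem fun _ _ => hall _, Finset.filter_true_of_mem fun _ _ => hall _]
  rw [card_splitG (F := F) (𝒯 := 𝒯) (fun q => ERG F q ∈ 𝓔), card_splitG (F := F) (𝒯 := 𝒯) (fun q => EBG F q ∈ 𝓔)]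
  have hB0 : ((QG F 𝒯).filter fun q => ERG F q ∈ 𝓔 ∧ F.core q.2 = false ∧ q.1 = sBotG).card = 0 := by
    rw [Finset.card_eq_zero, Finset.filter_eq_empty_iff]
    rintro q - ⟨hE', -, hs⟩
    apply hE
    have : ERG F q = ∅ := by
      rw [show q = (q.1, q.2) from rfl, hs]
      exact ERG_sBot q.2
    rw [this] at hE'
    exact hE'
  have hT0 : ((QG F 𝒯).filter fun q => EBG F q ∈ 𝓔 ∧ F.core q.2 = false ∧ q.1 = sTopG).card = 0 := by
    rw [Finset.card_eq_zero, Finset.filter_eq_empty_iff]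
    rintro q - ⟨hE', -, hs⟩
    apply hE
    have : EBG F q = ∅ := by
      rw [show q = (q.1, q.2) from rfl, hs]
      exact EBG_sTop q.2
    rw [this] at hE'
    exact hE'
  have hcore := core_le h𝒯 h𝓔
  have hslab := card_slab_leG h𝒯 h𝓔
  omega

end Count

end CrossArm

end Summit.Ventures.PercRepro2
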